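import Literature.AlgebraicTopology.CellComplexes.CubicalTorus
import Mathlib.LinearAlgebra.Dimension.Constructions
import Mathlib.LinearAlgebra.FreeModule.StrongRankCondition
import Mathlib.LinearAlgebra.StdBasis
import Mathlib.Data.Fintype.Powerset
import Mathlib.Data.Nat.Choose.Sum
import HarnessLib

/-!
# Homology of the cubical torus `(ℤ/N)^n`: `H_k ≅ R^{C(n,k)}`, `∑_k b_k = 2^n`

Topic `Literature/AlgebraicTopology/CellComplexes`, namespace
`Literature.AlgebraicTopology.CellComplexes.CubicalTorus`; companion of `CubicalTorus.lean`
(cells `(v, S)`, chains `Chain N n R = Cell N n → R`, `boundary`, `degree`, `homology`,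
`bettiNumber`).

**Result** (`homologyEquiv`, `bettiNumber_eq`, `sum_bettiNumber_eq`): for every `N ≥ 1`, `n`, and
every commutative ring `R`, the `k`-th cellular homology of the cubical torus `(ℤ/N)^n` is free on
the `k`-subsets of the `n` directions,

  `H_k((ℤ/N)^n; R) ≃ₗ[R] minimalDegree n R k`  (functions on `{S ⊆ Fin n | |S| = k}`),

so `bettiNumber N n R k = C(n, k)` for nontrivial `R` (in particular over `𝔽₂ = ZMod 2`) and
`∑_{k ≤ n} bettiNumber N n R k = 2^n`. This is the classical computation `H_k(T^n) ≅ R^{C(n,k)}`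
(Hatcher §3.3, pp. 230–231, via Künneth §3.B) for this particular CW structure.

**Proof** (explicit chain-homotopy equivalence; Mathlib has no Künneth formula at the pin). The
cubical torus complex is the `n`-fold tensor power of the cellular complex of the `N`-gon, and the
`N`-gon contracts onto the minimal circle (one vertex, one loop): `f(xᵃ) = w`,
`f(xᵃε) = [a = -1] ℓ`, `g(w) = x⁰`, `g(ℓ) = ∑ₐ xᵃε`, `fg = 1`, `1 - gf = ∂h + h∂` with
`h(xᵃ) = ∑_{b < a} xᵇε` (`a` read in `{0,…,N-1}`). We never form tensor products; instead we
write down the induced operators on the cubical chains coordinate by coordinate: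

* `proj i` (`= gf` in coordinate `i`) and `homotopyOp i` (`= h` in coordinate `i`, with the
  Koszul sign `sgn S i`), both `onCells`-defined;
* the local identities `∂ ∘ hᵢ + hᵢ ∘ ∂ = 1 - φᵢ` (`boundary_mul_homotopyOp_add`) and
  `∂ ∘ φᵢ = φᵢ ∘ ∂` (`boundary_mul_proj`), obtained from the one-coordinate computation
  (`dOp_mul_homotopyOp_add`, a telescoping sum over `{0,…,val vᵢ - 1}`) and the graded
  commutation of operators acting in different coordinates (`face_mul_homotopyOp_add_of_ne`, …);
* composing the homotopies (`projUpTo k = φ_{k-1} ∘ ⋯ ∘ φ₀`,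
  `homotopyUpTo (k+1) = h_k ∘ projUpTo k + homotopyUpTo k`):
  `∂ H + H ∂ = 1 - projUpTo n` (`boundary_homotopyUpTo`);
* the box formula `projUpTo_single` identifying `projUpTo n = fill ∘ read`, where
  `read : Chain → (Finset (Fin n) → R)` sends `(v, S)` to `e_S` if `v ≡ -1` on `S` and to `0`
  otherwise, and `fill e_S = ∑_{w ≡ 0 off S} (w, S)` (the fundamental cycles of the subtori);
  `read ∘ ∂ = 0`, `∂ ∘ fill = 0`, `read ∘ fill = 1`;
* hence `Z_k = fill(Λ_k) ⊕ B_k` and `H_k ≃ₗ Λ_k := minimalDegree n R k` (`homologyEquiv`), whose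
  rank is `#{S | |S| = k} = C(n,k)` (`finrank_minimalDegree`).

Also: `finrank_degree` (`rank C_k = N^n · C(n,k)`), for the Morse inequalities of the consumer
route.

## References

* A. Hatcher, *Algebraic Topology*, CUP (2002): §3.3 pp. 230–231 (`H_k(Tⁿ) ≅ ℤ^{C(n,k)}`), §3.B
  (Künneth, Prop. 3B.1), §2.2 (cellular homology). [HatcherAT2002]
-/

noncomputable section

open Finset

namespace Literature.AlgebraicTopology.CellComplexes

namespace CubicalTorus

variable {N n : ℕ}

section Ring

variable {R : Type*} [CommRing R] [NeZero N]

/-! ### Vertex arithmetic -/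

omit [NeZero N] in
/-- Off the direction `j`, translation by `eⱼ` does not change the coordinate. [folklore] -/
theorem add_single_apply_of_ne {v : Fin n → ZMod N} {i j : Fin n} (h : i ≠ j) :
    (v + Pi.single j 1 : Fin n → ZMod N) i = v i := by
  simp [Pi.single_eq_of_ne h]

omit [NeZero N] in
/-- Updating coordinate `i` commutes with translating by `eⱼ`, `j ≠ i`. [folklore] -/
theorem update_add_single_of_ne {v : Fin n → ZMod N} {i j : Fin n} (h : i ≠ j) (b : ZMod N) :
    Function.update (v + Pi.single j 1) i b = Function.update v i b + Pi.single j 1 := by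
  funext k
  by_cases hk : k = i
  · subst hk
    simp [Pi.single_eq_of_ne h]
  · simp [hk]

omit [NeZero N] in
/-- Updating coordinate `i` forgets a translation by `eᵢ`. [folklore] -/
theorem update_add_single_self (v : Fin n → ZMod N) (i : Fin n) (b : ZMod N) :
    Function.update (v + Pi.single i 1) i b = Function.update v i b := by
  funext k
  by_cases hk : k = i
  · subst hk
    simp
  · simp [hk]

omit [NeZero N] in
/-- Translating an updated vertex by `eᵢ` bumps the new coordinate. [folklore] -/
theorem update_add_single (v : Fin n → ZMod N) (i : Fin n) (b : ZMod N) :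
    Function.update v i b + Pi.single i 1 = Function.update v i (b + 1) := by
  funext k
  by_cases hk : k = i
  · subst hk
    simp
  · simp [hk]

/-- `val (a + 1) = val a + 1` unless `a = -1`. [folklore] -/
theorem val_add_one_of_ne {a : ZMod N} (h : a ≠ -1) : (a + 1).val = a.val + 1 := by
  have hlt : a.val + 1 < N := by
    have hle : a.val + 1 ≤ N := ZMod.val_lt a
    rcases hle.lt_or_eq with hlt | heq
    · exact hlt
    · exfalso
      apply h
      have h1 : ((a.val + 1 : ℕ) : ZMod N) = 0 := by rw [heq, ZMod.natCast_self]
      rw [Nat.cast_succ, ZMod.natCast_zmod_val] at h1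
      exact eq_neg_of_add_eq_zero_left h1
  have h2 : a + 1 = ((a.val + 1 : ℕ) : ZMod N) := by rw [Nat.cast_succ, ZMod.natCast_zmod_val]
  rw [h2, ZMod.val_natCast_of_lt hlt]

/-- `val (-1) + 1 = N`. [folklore] -/
theorem val_add_one_of_eq {a : ZMod N} (h : a = -1) : a.val + 1 = N := by
  subst h
  obtain ⟨m, hm⟩ := Nat.exists_eq_succ_of_ne_zero (NeZero.ne N)
  subst hm
  rw [ZMod.val_neg_one]

/-- A sum over `ZMod N` is a sum over the representatives `0, …, N-1`. [folklore] -/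
theorem sum_univ_zmod {M : Type*} [AddCommMonoid M] (g : ZMod N → M) :
    ∑ a, g a = ∑ b ∈ Finset.range N, g b := by
  refine Finset.sum_nbij' (fun a => a.val) (fun b => (b : ZMod N)) ?_ ?_ ?_ ?_ ?_
  · exact fun a _ => Finset.mem_range.2 (ZMod.val_lt a)
  · exact fun b _ => Finset.mem_univ _
  · exact fun a _ => ZMod.natCast_zmod_val a
  · exact fun b hb => ZMod.val_natCast_of_lt (Finset.mem_range.1 hb)
  · exact fun a _ => by rw [ZMod.natCast_zmod_val]

/-! ### The local homotopy operators -/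

variable (N n) (R)

/-- `φᵢ = g ∘ f` in coordinate `i`: a cell without the direction `i` is moved to base coordinate
`vᵢ = 0`; a cell with the direction `i` is sent to the full circle `∑ₐ (v[i ↦ a], S)` if
`vᵢ = -1` and to `0` otherwise. [folklore] -/
def proj (i : Fin n) : Module.End R (Chain N n R) :=
  onCells R fun c =>
    if i ∈ c.2 then
      (if c.1 i = -1 then ∑ a : ZMod N, Pi.single (Function.update c.1 i a, c.2) 1 else 0)
    else Pi.single (Function.update c.1 i 0, c.2) 1

/-- `hᵢ`, the homotopy in coordinate `i` (with its Koszul sign): a cell without the direction `i`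
and base coordinate `vᵢ = a` is sent to the path of edges `∑_{b < a} (v[i ↦ b], S ∪ {i})` from
`vᵢ = 0` to `vᵢ = a`; cells with the direction `i` go to `0`. [folklore] -/
def homotopyOp (i : Fin n) : Module.End R (Chain N n R) :=
  onCells R fun c =>
    if i ∈ c.2 then 0
    else sgn R c.2 i • ∑ b ∈ Finset.range (c.1 i).val,
      Pi.single (Function.update c.1 i (b : ZMod N), insert i c.2) 1

variable {N n R}

/-- `proj i` on a cell. [folklore] -/
theorem proj_single (i : Fin n) (c : Cell N n) (r : R) :
    proj N n R i (Pi.single c r) =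
      if i ∈ c.2 then
        (if c.1 i = -1 then ∑ a : ZMod N, Pi.single (Function.update c.1 i a, c.2) r else 0)
      else Pi.single (Function.update c.1 i 0, c.2) r := by
  unfold proj
  rw [onCells_single]
  split_ifs <;> simp [Finset.smul_sum, smul_single_one]

/-- `homotopyOp i` on a cell. [folklore] -/
theorem homotopyOp_single (i : Fin n) (c : Cell N n) (r : R) :
    homotopyOp N n R i (Pi.single c r) =
      if i ∈ c.2 then 0
      else ∑ b ∈ Finset.range (c.1 i).val,
        Pi.single (Function.update c.1 i (b : ZMod N), insert i c.2) (sgn R c.2 i * r) := by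
  unfold homotopyOp
  rw [onCells_single]
  split_ifs <;> simp [Finset.smul_sum, smul_single, mul_comm]

/-- Translations in direction `j` commute with `hᵢ`, `i ≠ j`. [folklore] -/
theorem shift_mul_homotopyOp_of_ne {i j : Fin n} (hij : i ≠ j) :
    shift N n R j * homotopyOp N n R i = homotopyOp N n R i * shift N n R j := by
  refine hom_ext fun c => ?_
  obtain ⟨v, S⟩ := c
  by_cases hi : i ∈ S
  · simp [homotopyOp_single, hi]
  · simp [homotopyOp_single, hi, map_sum, Pi.single_eq_of_ne hij, update_add_single_of_ne hij]

/-- The signed contraction of `j` anticommutes with `hᵢ`, `i ≠ j`. [folklore] -/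
theorem face_mul_homotopyOp_add_of_ne {i j : Fin n} (hij : i ≠ j) :
    face N n R j * homotopyOp N n R i + homotopyOp N n R i * face N n R j = 0 := by
  refine hom_ext fun c => ?_
  obtain ⟨v, S⟩ := c
  by_cases hi : i ∈ S
  · by_cases hj : j ∈ S
    · have hi' : i ∈ S.erase j := Finset.mem_erase.2 ⟨hij, hi⟩
      simp [homotopyOp_single, hi, hj, hi']
    · simp [homotopyOp_single, hi, hj]
  · by_cases hj : j ∈ S
    · have hi' : i ∉ S.erase j := fun h => hi (Finset.mem_of_mem_erase h)
      have hj' : j ∈ insert i S := Finset.mem_insert_of_mem hj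
      simp only [LinearMap.add_apply, Module.End.mul_apply, LinearMap.zero_apply,
        homotopyOp_single, face_single, hi, hj, hi', hj', if_true, if_false, map_sum, mul_one,
        Finset.erase_insert_of_ne hij, ← Finset.sum_add_distrib, ← Pi.single_add]
      refine Finset.sum_eq_zero fun b _ => ?_
      rw [Pi.single_eq_zero_iff]
      rcases lt_or_gt_of_ne hij with h | h
      · rw [sgn_insert_of_lt hi h, sgn_erase_of_not_lt (not_lt.2 h.le)]
        ring
      · rw [sgn_insert_of_not_lt (not_lt.2 h.le), sgn_erase_of_lt hj h]
        ring
    · have hj' : j ∉ insert i S := by simp [hj, hij.symm]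
      simp [homotopyOp_single, hi, hj, hj', map_sum]

/-- Translations in direction `j` commute with `φᵢ`, `i ≠ j`. [folklore] -/
theorem shift_mul_proj_of_ne {i j : Fin n} (hij : i ≠ j) :
    shift N n R j * proj N n R i = proj N n R i * shift N n R j := by
  refine hom_ext fun c => ?_
  obtain ⟨v, S⟩ := c
  by_cases hi : i ∈ S <;> by_cases hv : v i = -1 <;>
    simp [proj_single, hi, hv, map_sum, Pi.single_eq_of_ne hij, update_add_single_of_ne hij]

/-- The signed contraction of `j` commutes with `φᵢ`, `i ≠ j`. [folklore] -/
theorem face_mul_proj_of_ne {i j : Fin n} (hij : i ≠ j) :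
    face N n R j * proj N n R i = proj N n R i * face N n R j := by
  refine hom_ext fun c => ?_
  obtain ⟨v, S⟩ := c
  by_cases hj : j ∈ S
  · have hiff : i ∈ S.erase j ↔ i ∈ S := by simp [Finset.mem_erase, hij]
    by_cases hi : i ∈ S <;> by_cases hv : v i = -1 <;>
      simp [proj_single, hi, hj, hv, hiff, map_sum]
  · by_cases hi : i ∈ S <;> by_cases hv : v i = -1 <;>
      simp [proj_single, hi, hj, hv, map_sum]

/-- **The one-coordinate homotopy**: `∂ᵢ ∘ hᵢ + hᵢ ∘ ∂ᵢ = 1 - φᵢ` (the `N`-gon contracts onto the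
minimal circle). [folklore] -/
theorem dOp_mul_homotopyOp_add (i : Fin n) :
    dOp N n R i * homotopyOp N n R i + homotopyOp N n R i * dOp N n R i = 1 - proj N n R i := by
  refine hom_ext fun c => ?_
  simp only [LinearMap.add_apply, LinearMap.sub_apply, Module.End.one_apply, Module.End.mul_apply]
  -- the telescoping family
  set g : ℕ → Chain N n R := fun b => Pi.single (Function.update c.1 i (b : ZMod N), c.2) 1 with hg
  have hg_val : g (c.1 i).val = Pi.single c 1 := by
    simp [hg]
  by_cases hi : i ∈ c.2
  · -- `dᵢ hᵢ = 0`, `hᵢ dᵢ` telescopes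
    have hi' : i ∉ c.2.erase i := Finset.notMem_erase i c.2
    have h1 : homotopyOp N n R i (dOp N n R i (Pi.single c 1)) =
        ∑ b ∈ Finset.range (c.1 i + 1).val, g b - ∑ b ∈ Finset.range (c.1 i).val, g b := by
      rw [dOp_single, if_pos hi, map_sub]
      simp only [Cell.front, Cell.back, homotopyOp_single, hi', if_false, Finset.insert_erase hi,
        update_add_single_self, sgn_erase_of_not_lt (lt_irrefl i), sgn_mul_sgn_mul, Pi.add_apply,
        Pi.single_eq_same, hg]
    rw [homotopyOp_single, if_pos hi, map_zero, zero_add, h1, proj_single, if_pos hi]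
    by_cases hv : c.1 i = -1
    · have hN : Finset.range N = Finset.range ((c.1 i).val + 1) := by rw [val_add_one_of_eq hv]
      have hsum : ∑ a : ZMod N, (Pi.single (Function.update c.1 i a, c.2) (1 : R) : Chain N n R) =
          ∑ b ∈ Finset.range (c.1 i).val, g b + g (c.1 i).val := by
        rw [sum_univ_zmod fun a => (Pi.single (Function.update c.1 i a, c.2) (1 : R) : Chain N n R),
          hN, Finset.sum_range_succ]
      rw [if_pos hv, show c.1 i + 1 = 0 by rw [hv]; ring, ZMod.val_zero, Finset.range_zero,
        Finset.sum_empty, zero_sub, hsum, hg_val]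
      abel
    · rw [if_neg hv, val_add_one_of_ne hv, Finset.sum_range_succ, hg_val]
      abel
  · -- `hᵢ dᵢ = 0`, `dᵢ hᵢ` telescopes
    have hi' : i ∈ insert i c.2 := Finset.mem_insert_self i c.2
    have h1 : dOp N n R i (homotopyOp N n R i (Pi.single c 1)) =
        ∑ b ∈ Finset.range (c.1 i).val, (g (b + 1) - g b) := by
      rw [homotopyOp_single, if_neg hi, map_sum]
      refine Finset.sum_congr rfl fun b _ => ?_
      rw [dOp_single, if_pos hi']
      simp only [Cell.front, Cell.back, Finset.erase_insert hi, update_add_single,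
        sgn_insert_of_not_lt (lt_irrefl i), mul_one, sgn_mul_self, hg, Nat.cast_succ]
    rw [dOp_single, if_neg hi, map_zero, add_zero, h1, Finset.sum_range_sub, hg_val, proj_single,
      if_neg hi]
    simp [hg]

/-- `∂ᵢ` commutes with `φᵢ`. [folklore] -/
theorem dOp_mul_proj (i : Fin n) : dOp N n R i * proj N n R i = proj N n R i * dOp N n R i := by
  refine hom_ext fun c => ?_
  obtain ⟨v, S⟩ := c
  simp only [Module.End.mul_apply]
  by_cases hi : i ∈ S
  · have hi' : i ∉ S.erase i := Finset.notMem_erase i S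
    rw [dOp_single, if_pos hi, map_sub, proj_single, if_pos hi]
    simp only [Cell.front, Cell.back, proj_single, hi', if_false, update_add_single_self, sub_self]
    split_ifs with hv
    · rw [map_sum]
      simp only [dOp_single, hi, if_true, Cell.front, Cell.back, update_add_single,
        Finset.sum_sub_distrib]
      rw [sub_eq_zero]
      exact Fintype.sum_equiv (Equiv.addRight 1)
        (fun a => (Pi.single (Function.update v i (a + 1), S.erase i) (sgn R S i * 1) : Chain N n R))
        (fun a => Pi.single (Function.update v i a, S.erase i) (sgn R S i * 1)) fun a => rfl
    · rw [map_zero]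
  · rw [dOp_single, if_neg hi, map_zero, proj_single, if_neg hi, dOp_single]
    simp [hi]

/-- **`∂ ∘ hᵢ + hᵢ ∘ ∂ = 1 - φᵢ`** on the whole complex. [folklore] -/
theorem boundary_mul_homotopyOp_add (i : Fin n) :
    boundary N n R * homotopyOp N n R i + homotopyOp N n R i * boundary N n R = 1 - proj N n R i := by
  rw [boundary_eq_sum_dOp, Finset.sum_mul, Finset.mul_sum, ← Finset.sum_add_distrib,
    Fintype.sum_eq_single i fun j hj => ?_, dOp_mul_homotopyOp_add]
  have hij : i ≠ j := fun h => hj h.symm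
  have h1 : (shift N n R j - 1) * homotopyOp N n R i = homotopyOp N n R i * (shift N n R j - 1) := by
    rw [sub_mul, mul_sub, one_mul, mul_one, shift_mul_homotopyOp_of_ne hij]
  rw [dOp, mul_assoc, ← mul_assoc (homotopyOp N n R i), ← h1, mul_assoc, ← mul_add,
    face_mul_homotopyOp_add_of_ne hij, mul_zero]

/-- `∂` commutes with `φᵢ`. [folklore] -/
theorem boundary_mul_proj (i : Fin n) :
    boundary N n R * proj N n R i = proj N n R i * boundary N n R := by
  rw [boundary_eq_sum_dOp, Finset.sum_mul, Finset.mul_sum]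
  refine Finset.sum_congr rfl fun j _ => ?_
  rcases eq_or_ne i j with rfl | hij
  · exact dOp_mul_proj i
  · have h1 : (shift N n R j - 1) * proj N n R i = proj N n R i * (shift N n R j - 1) := by
      rw [sub_mul, mul_sub, one_mul, mul_one, shift_mul_proj_of_ne hij]
    rw [dOp, mul_assoc, face_mul_proj_of_ne hij, ← mul_assoc, h1, mul_assoc]

/-! ### Composing the coordinate homotopies -/

variable (N n R)

/-- `φ_k` for `k < n`, and `1` beyond. [folklore] -/
def projStep (k : ℕ) : Module.End R (Chain N n R) :=
  if h : k < n then proj N n R ⟨k, h⟩ else 1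

/-- `h_k` for `k < n`, and `0` beyond. [folklore] -/
def homotopyStep (k : ℕ) : Module.End R (Chain N n R) :=
  if h : k < n then homotopyOp N n R ⟨k, h⟩ else 0

/-- `Ψ_k = φ_{k-1} ∘ ⋯ ∘ φ₀`: the coordinates `< k` processed. [folklore] -/
def projUpTo : ℕ → Module.End R (Chain N n R)
  | 0 => 1
  | k + 1 => projStep N n R k * projUpTo k

/-- `H_k = ∑_{i<k} hᵢ ∘ Ψᵢ`, the composed homotopy. [folklore] -/
def homotopyUpTo : ℕ → Module.End R (Chain N n R)
  | 0 => 0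
  | k + 1 => homotopyStep N n R k * projUpTo N n R k + homotopyUpTo k

variable {N n R}

/-- `∂` commutes with `projStep k`. [folklore] -/
theorem boundary_mul_projStep (k : ℕ) :
    boundary N n R * projStep N n R k = projStep N n R k * boundary N n R := by
  unfold projStep
  split_ifs with h
  · exact boundary_mul_proj _
  · rw [mul_one, one_mul]

/-- `∂ hₖ + hₖ ∂ = 1 - φₖ` for the padded operators. [folklore] -/
theorem boundary_homotopyStep (k : ℕ) :
    boundary N n R * homotopyStep N n R k + homotopyStep N n R k * boundary N n R =
      1 - projStep N n R k := by
  unfold homotopyStep projStep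
  split_ifs with h
  · exact boundary_mul_homotopyOp_add _
  · rw [mul_zero, zero_mul, add_zero, sub_self]

/-- `∂` commutes with `Ψ_k`. [folklore] -/
theorem boundary_mul_projUpTo (k : ℕ) :
    boundary N n R * projUpTo N n R k = projUpTo N n R k * boundary N n R := by
  induction k with
  | zero => simp [projUpTo]
  | succ k ih => rw [projUpTo, ← mul_assoc, boundary_mul_projStep, mul_assoc, ih, mul_assoc]

/-- **The homotopy identity** `∂ ∘ H_k + H_k ∘ ∂ = 1 - Ψ_k` (composition of maps homotopic to
the identity). [folklore] -/
theorem boundary_homotopyUpTo (k : ℕ) :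
    boundary N n R * homotopyUpTo N n R k + homotopyUpTo N n R k * boundary N n R =
      1 - projUpTo N n R k := by
  induction k with
  | zero => simp [homotopyUpTo, projUpTo]
  | succ k ih =>
    rw [homotopyUpTo, projUpTo]
    have e2 : homotopyStep N n R k * projUpTo N n R k * boundary N n R =
        homotopyStep N n R k * boundary N n R * projUpTo N n R k := by
      rw [mul_assoc, ← boundary_mul_projUpTo, ← mul_assoc]
    have e3 : boundary N n R * homotopyStep N n R k * projUpTo N n R k +
        homotopyStep N n R k * boundary N n R * projUpTo N n R k =
          (1 - projStep N n R k) * projUpTo N n R k := by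
      rw [← add_mul, boundary_homotopyStep]
    calc boundary N n R * (homotopyStep N n R k * projUpTo N n R k + homotopyUpTo N n R k) +
          (homotopyStep N n R k * projUpTo N n R k + homotopyUpTo N n R k) * boundary N n R
        = (boundary N n R * homotopyStep N n R k * projUpTo N n R k +
            homotopyStep N n R k * boundary N n R * projUpTo N n R k) +
          (boundary N n R * homotopyUpTo N n R k + homotopyUpTo N n R k * boundary N n R) := by
          rw [mul_add, add_mul, e2, ← mul_assoc]
          abel
      _ = 1 - projStep N n R k * projUpTo N n R k := by
          rw [e3, ih, sub_mul, one_mul]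
          abel

/-! ### The box formula for `Ψ_k` -/

variable (N) in
/-- After processing the coordinates `< k`, the cell `(v, S)` has spread over the box of vertices
`w` with `wⱼ = vⱼ` (`j ≥ k`), `wⱼ` arbitrary (`j < k`, `j ∈ S`), `wⱼ = 0` (`j < k`, `j ∉ S`).
[folklore] -/
def boxFun (k : ℕ) (v : Fin n → ZMod N) (S : Finset (Fin n)) (j : Fin n) : Finset (ZMod N) :=
  if k ≤ j.val then {v j} else if j ∈ S then Finset.univ else {0}

variable (N) in
/-- The box of `boxFun`. [folklore] -/
def box (k : ℕ) (v : Fin n → ZMod N) (S : Finset (Fin n)) : Finset (Fin n → ZMod N) :=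
  Fintype.piFinset (boxFun N k v S)

/-- Before any processing the box is `{v}`. [folklore] -/
theorem box_zero (v : Fin n → ZMod N) (S : Finset (Fin n)) : box N 0 v S = {v} := by
  have h : boxFun N 0 v S = fun j => {v j} := funext fun j => by simp [boxFun]
  rw [box, h, Fintype.piFinset_singleton]

/-- The unprocessed coordinate `k` of a vertex of `box k` is that of `v`. [folklore] -/
theorem apply_eq_of_mem_box {k : ℕ} {v w : Fin n → ZMod N} {S : Finset (Fin n)}
    (hw : w ∈ box N k v S) (j : Fin n) (hj : k ≤ j.val) : w j = v j := by
  have h := Fintype.mem_piFinset.1 hw j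
  simpa [boxFun, hj] using h

/-- Processing coordinate `k` replaces `{v_k}` by the full circle or by `{0}`. [folklore] -/
theorem boxFun_succ {k : ℕ} (hk : k < n) (v : Fin n → ZMod N) (S : Finset (Fin n)) :
    boxFun N (k + 1) v S =
      Function.update (boxFun N k v S) ⟨k, hk⟩
        (if (⟨k, hk⟩ : Fin n) ∈ S then Finset.univ else {0}) := by
  funext j
  by_cases hj : j = ⟨k, hk⟩
  · subst hj
    simp [boxFun]
  · rw [Function.update_of_ne hj]
    have hjk : j.val ≠ k := fun h => hj (Fin.ext h)
    have hiff : (k + 1 ≤ j.val) ↔ (k ≤ j.val) := by omega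
    simp only [boxFun, hiff]

/-- `boxFun k` at the coordinate `k` is `{v_k}`. [folklore] -/
theorem boxFun_self {k : ℕ} (hk : k < n) (v : Fin n → ZMod N) (S : Finset (Fin n)) :
    boxFun N k v S ⟨k, hk⟩ = {v ⟨k, hk⟩} := by
  simp [boxFun]

/-- Beyond `n` nothing changes. [folklore] -/
theorem boxFun_succ_of_le {k : ℕ} (hk : n ≤ k) (v : Fin n → ZMod N) (S : Finset (Fin n)) :
    boxFun N (k + 1) v S = boxFun N k v S := by
  funext j
  have h1 : ¬ k + 1 ≤ j.val := by have := j.isLt; omega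
  have h2 : ¬ k ≤ j.val := by have := j.isLt; omega
  simp only [boxFun, h1, h2, if_false]

/-- **Fubini for one coordinate**: summing over a box with `i`-th factor `{c}` and then over
`a ∈ s` substituted at `i` is summing over the box with `i`-th factor `s`. [folklore] -/
theorem sum_piFinset_update {ι : Type*} [Fintype ι] [DecidableEq ι] {α : Type*} [DecidableEq α]
    {M : Type*} [AddCommMonoid M] (t : ι → Finset α) (i : ι) {c : α} (ht : t i = {c})
    (s : Finset α) (g : (ι → α) → M) :
    ∑ w ∈ Fintype.piFinset t, ∑ a ∈ s, g (Function.update w i a) =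
      ∑ w ∈ Fintype.piFinset (Function.update t i s), g w := by
  rw [← Finset.sum_product']
  refine Finset.sum_nbij' (fun p => Function.update p.1 i p.2) (fun w => (Function.update w i c, w i))
    ?_ ?_ ?_ ?_ ?_
  · rintro ⟨w, a⟩ hp
    simp only [Finset.mem_product, Fintype.mem_piFinset] at hp ⊢
    intro j
    by_cases hj : j = i
    · subst hj
      simpa using hp.2
    · simpa [hj, Function.update_of_ne hj] using hp.1 j
  · intro w hw
    simp only [Finset.mem_product, Fintype.mem_piFinset] at hw ⊢
    refine ⟨fun j => ?_, by simpa using hw i⟩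
    by_cases hj : j = i
    · subst hj
      simp [ht]
    · simpa [hj, Function.update_of_ne hj] using hw j
  · rintro ⟨w, a⟩ hp
    simp only [Finset.mem_product, Fintype.mem_piFinset] at hp
    have hwi : w i = c := by simpa [ht] using hp.1 i
    refine Prod.ext ?_ ?_
    · simp only [Function.update_idem]
      rw [← hwi, Function.update_eq_self]
    · simp
  · intro w _
    simp
  · intro p _
    rfl

/-- **The box formula**: `Ψ_k (v, S) = ∑_{w ∈ box k v S} (w, S)` if `vⱼ = -1` for all processed
free directions `j ∈ S`, `j < k`, and `0` otherwise. [folklore] -/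
theorem projUpTo_single (k : ℕ) (v : Fin n → ZMod N) (S : Finset (Fin n)) :
    projUpTo N n R k (Pi.single (v, S) 1) =
      if ∀ j ∈ S, j.val < k → v j = -1 then ∑ w ∈ box N k v S, Pi.single (w, S) 1 else 0 := by
  induction k with
  | zero => simp [projUpTo, box_zero]
  | succ k ih =>
    rw [projUpTo, Module.End.mul_apply, ih]
    by_cases hk : k < n
    · set i : Fin n := ⟨k, hk⟩ with hi_def
      have hcond : (∀ j ∈ S, j.val < k + 1 → v j = -1) ↔
          (∀ j ∈ S, j.val < k → v j = -1) ∧ (i ∈ S → v i = -1) := by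
        constructor
        · exact fun h => ⟨fun j hj hjk => h j hj (by omega), fun hiS => h i hiS (by simp [i])⟩
        · rintro ⟨h1, h2⟩ j hj hjk
          rcases (Nat.lt_succ_iff_lt_or_eq).1 hjk with hlt | heq
          · exact h1 j hj hlt
          · have hji : j = i := Fin.ext heq
            subst hji
            exact h2 hj
      have hbox : box N (k + 1) v S =
          Fintype.piFinset (Function.update (boxFun N k v S) i
            (if i ∈ S then Finset.univ else {0})) := by
        rw [box, boxFun_succ hk]
      rw [projStep, dif_pos hk]
      by_cases hc : ∀ j ∈ S, j.val < k → v j = -1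
      · rw [if_pos hc, map_sum]
        have hw : ∀ w ∈ box N k v S, w i = v i := fun w hw => apply_eq_of_mem_box hw i le_rfl
        by_cases hiS : i ∈ S
        · by_cases hv : v i = -1
          · rw [if_pos (hcond.2 ⟨hc, fun _ => hv⟩), hbox, if_pos hiS,
              ← sum_piFinset_update (boxFun N k v S) i (boxFun_self hk v S) Finset.univ
                (fun w => (Pi.single (w, S) (1 : R) : Chain N n R))]
            refine Finset.sum_congr rfl fun w hw' => ?_
            rw [proj_single, if_pos hiS, if_pos ((hw w hw').trans hv)]
          · rw [if_neg fun h => hv ((hcond.1 h).2 hiS)]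
            refine Finset.sum_eq_zero fun w hw' => ?_
            rw [proj_single, if_pos hiS, if_neg ((hw w hw').trans_ne hv)]
        · rw [if_pos (hcond.2 ⟨hc, fun h => absurd h hiS⟩), hbox, if_neg hiS,
            ← sum_piFinset_update (boxFun N k v S) i (boxFun_self hk v S) {0}
              (fun w => (Pi.single (w, S) (1 : R) : Chain N n R))]
          refine Finset.sum_congr rfl fun w _ => ?_
          rw [proj_single, if_neg hiS, Finset.sum_singleton]
      · rw [if_neg hc, map_zero, if_neg fun h => hc (hcond.1 h).1]
    · rw [projStep, dif_neg hk, Module.End.one_apply]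
      have hcond : (∀ j ∈ S, j.val < k + 1 → v j = -1) ↔ (∀ j ∈ S, j.val < k → v j = -1) := by
        constructor
        · exact fun h j hj hjk => h j hj (by omega)
        · exact fun h j hj _ => h j hj (by have := j.isLt; omega)
      have hbox : box N (k + 1) v S = box N k v S := by
        rw [box, box, boxFun_succ_of_le (not_lt.1 hk)]
      rw [hbox]
      exact if_congr hcond.symm rfl rfl

/-! ### The comparison maps with the minimal complex -/

variable (n R) in
/-- The chains of the **minimal cell structure** of the `n`-torus (one cell `e_S` for each set `S`
of directions, zero differential): functions on `Finset (Fin n)`. [folklore] -/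
abbrev MinimalChain : Type _ := Finset (Fin n) → R

variable (n R) in
/-- The `k`-chains of the minimal complex: functions supported on the `k`-sets. [folklore] -/
def minimalDegree (k : ℕ) : Submodule R (MinimalChain n R) where
  carrier := {f | ∀ S, f S ≠ 0 → S.card = k}
  add_mem' {x y} hx hy S hS := by
    by_contra h
    have hx' : x S = 0 := not_imp_comm.1 (hx S) h
    have hy' : y S = 0 := not_imp_comm.1 (hy S) h
    exact hS (by simp [hx', hy'])
  zero_mem' S hS := absurd rfl hS
  smul_mem' r x hx S hS := hx S fun h => hS (by simp [h])

omit [NeZero N] in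
/-- `e_S` is a `|S|`-chain of the minimal complex. [folklore] -/
theorem single_mem_minimalDegree {S : Finset (Fin n)} {k : ℕ} (h : S.card = k) (r : R) :
    (Pi.single S r : MinimalChain n R) ∈ minimalDegree n R k := by
  intro S' hS'
  by_cases hSS : S' = S
  · rw [hSS, h]
  · exact absurd (by simp [hSS]) hS'

omit [NeZero N] in
/-- The `k`-chains of the minimal complex are spanned by the `e_S`, `|S| = k`. [folklore] -/
theorem minimalDegree_eq_span (k : ℕ) :
    minimalDegree n R k =
      Submodule.span R (Set.range fun S : {S : Finset (Fin n) // S.card = k} =>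
        (Pi.single S.1 (1 : R) : MinimalChain n R)) := by
  refine le_antisymm (fun x hx => ?_) ?_
  · rw [← Finset.univ_sum_single x]
    refine Submodule.sum_mem _ fun S _ => ?_
    by_cases hS : x S = 0
    · rw [hS, Pi.single_zero]
      exact Submodule.zero_mem _
    · rw [show (Pi.single S (x S) : MinimalChain n R) = x S • Pi.single S 1 by
        rw [← Pi.single_smul', smul_eq_mul, mul_one]]
      exact Submodule.smul_mem _ _ (Submodule.subset_span ⟨⟨S, hx S hS⟩, rfl⟩)
  · rw [Submodule.span_le]
    rintro _ ⟨S, rfl⟩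
    exact single_mem_minimalDegree S.2 1

omit [NeZero N] in
/-- **`rank Λ_k = C(n, k)`.** [folklore] -/
theorem finrank_minimalDegree [Nontrivial R] (k : ℕ) :
    Module.finrank R (minimalDegree n R k) = n.choose k := by
  have hli : LinearIndependent R fun S : {S : Finset (Fin n) // S.card = k} =>
      (Pi.single S.1 (1 : R) : MinimalChain n R) :=
    (Pi.linearIndependent_single_one (Finset (Fin n)) R).comp _ Subtype.val_injective
  rw [minimalDegree_eq_span, finrank_span_eq_card hli, Fintype.card_finset_len, Fintype.card_fin]

variable (N n R)

/-- The vertices of the subtorus spanned by the directions `S` through the origin: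
`wⱼ = 0` off `S`. [folklore] -/
def topBox (S : Finset (Fin n)) : Finset (Fin n → ZMod N) :=
  Fintype.piFinset fun j => if j ∈ S then Finset.univ else {0}

/-- `read = f^{⊗n}`: the cell `(v, S)` is sent to `e_S` if `vⱼ = -1` for all `j ∈ S`, and to `0`
otherwise. [folklore] -/
def read : Chain N n R →ₗ[R] MinimalChain n R :=
  Fintype.linearCombination R fun c => if ∀ j ∈ c.2, c.1 j = -1 then Pi.single c.2 1 else 0

/-- `fill = g^{⊗n}`: `e_S` is sent to the fundamental cycle `∑_{w ∈ topBox S} (w, S)` of the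
subtorus in the directions `S`. [folklore] -/
def fill : MinimalChain n R →ₗ[R] Chain N n R :=
  Fintype.linearCombination R fun S => ∑ w ∈ topBox N n S, Pi.single (w, S) 1

variable {N n R}

/-- `read` on a cell. [folklore] -/
theorem read_single (c : Cell N n) (r : R) :
    read N n R (Pi.single c r) = if ∀ j ∈ c.2, c.1 j = -1 then Pi.single c.2 r else 0 := by
  rw [read, Fintype.linearCombination_apply_single]
  split_ifs <;> simp [← Pi.single_smul']

/-- `fill` on a set of directions. [folklore] -/
theorem fill_single (S : Finset (Fin n)) (r : R) :
    fill N n R (Pi.single S r) = ∑ w ∈ topBox N n S, Pi.single (w, S) r := by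
  rw [fill, Fintype.linearCombination_apply_single, Finset.smul_sum]
  simp only [smul_single_one]

/-- Linear maps out of the minimal chains are determined by the `e_S`. [folklore] -/
theorem minimal_hom_ext {M : Type*} [AddCommGroup M] [Module R M]
    {f g : MinimalChain n R →ₗ[R] M}
    (h : ∀ S : Finset (Fin n), f (Pi.single S 1) = g (Pi.single S 1)) : f = g :=
  LinearMap.pi_ext' fun S => LinearMap.ext_ring (h S)

/-- After all coordinates are processed the box is `topBox`. [folklore] -/
theorem box_of_le {k : ℕ} (hk : n ≤ k) (v : Fin n → ZMod N) (S : Finset (Fin n)) :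
    box N k v S = topBox N n S := by
  unfold box topBox boxFun
  congr 1
  funext j
  have h : ¬ k ≤ j.val := by have := j.isLt; omega
  rw [if_neg h]

/-- **`fill ∘ read = Ψ_n`**. [folklore] -/
theorem fill_comp_read : fill N n R ∘ₗ read N n R = projUpTo N n R n := by
  refine hom_ext fun c => ?_
  obtain ⟨v, S⟩ := c
  rw [LinearMap.comp_apply, read_single, projUpTo_single, box_of_le le_rfl]
  have hcond : (∀ j ∈ S, j.val < n → v j = -1) ↔ ∀ j ∈ S, v j = -1 :=
    ⟨fun h j hj => h j hj j.isLt, fun h j hj _ => h j hj⟩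
  rw [if_congr hcond rfl rfl]
  split_ifs
  · exact fill_single S 1
  · exact map_zero _

/-- **`read ∘ ∂ = 0`** (`f` is a chain map to a complex with zero differential). [folklore] -/
theorem read_comp_boundary : read N n R ∘ₗ boundary N n R = 0 := by
  refine hom_ext fun c => ?_
  rw [LinearMap.comp_apply, LinearMap.zero_apply, boundary_single, cellBoundary_eq, map_sum]
  refine Finset.sum_eq_zero fun i hi => ?_
  have hiff : (∀ j ∈ c.2.erase i, (c.1 + Pi.single i 1 : Fin n → ZMod N) j = -1) ↔
      ∀ j ∈ c.2.erase i, c.1 j = -1 := by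
    refine forall₂_congr fun j hj => ?_
    rw [add_single_apply_of_ne (Finset.ne_of_mem_erase hj)]
  rw [map_sub, read_single, read_single]
  simp only [Cell.front, Cell.back]
  rw [if_congr hiff rfl rfl, sub_self]

/-- Translating the fundamental cycle of a subtorus along one of its directions permutes its
cells. [folklore] -/
theorem sum_topBox_add_single {M : Type*} [AddCommMonoid M] {S : Finset (Fin n)} {i : Fin n}
    (hi : i ∈ S) (g : (Fin n → ZMod N) → M) :
    ∑ w ∈ topBox N n S, g (w + Pi.single i 1) = ∑ w ∈ topBox N n S, g w := by
  refine Finset.sum_nbij' (fun w => w + Pi.single i 1) (fun w => w - Pi.single i 1) ?_ ?_ ?_ ?_ ?_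
  · intro w hw
    simp only [topBox, Fintype.mem_piFinset] at hw ⊢
    intro j
    by_cases hj : j ∈ S
    · simp [hj]
    · have hji : j ≠ i := fun h => hj (h ▸ hi)
      simpa [hj, Pi.single_eq_of_ne hji] using hw j
  · intro w hw
    simp only [topBox, Fintype.mem_piFinset] at hw ⊢
    intro j
    by_cases hj : j ∈ S
    · simp [hj]
    · have hji : j ≠ i := fun h => hj (h ▸ hi)
      simpa [hj, Pi.single_eq_of_ne hji] using hw j
  · intro w _
    simp
  · intro w _
    simp
  · intro w _
    rfl

/-- **`∂ ∘ fill = 0`** (the fundamental cycles of the subtori are cycles). [folklore] -/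
theorem boundary_comp_fill : boundary N n R ∘ₗ fill N n R = 0 := by
  refine minimal_hom_ext fun S => ?_
  rw [LinearMap.comp_apply, LinearMap.zero_apply, fill_single, map_sum]
  simp only [boundary_single, cellBoundary_eq, Cell.front, Cell.back]
  rw [Finset.sum_comm]
  refine Finset.sum_eq_zero fun i hi => ?_
  rw [Finset.sum_sub_distrib, sub_eq_zero]
  exact sum_topBox_add_single hi fun w => (Pi.single (w, S.erase i) (sgn R S i) : Chain N n R)

/-- **`read ∘ fill = 1`**: exactly one cell of the fundamental cycle of the `S`-subtorus has all
its `S`-coordinates equal to `-1`. [folklore] -/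
theorem read_comp_fill : read N n R ∘ₗ fill N n R = LinearMap.id := by
  refine minimal_hom_ext fun S => ?_
  rw [LinearMap.comp_apply, LinearMap.id_apply, fill_single, map_sum]
  simp only [read_single]
  have hfilter : (topBox N n S).filter (fun w : Fin n → ZMod N => ∀ j ∈ S, w j = -1) =
      {fun j => if j ∈ S then -1 else 0} := by
    ext w
    simp only [Finset.mem_filter, topBox, Fintype.mem_piFinset, Finset.mem_singleton]
    constructor
    · rintro ⟨h1, h2⟩
      funext j
      by_cases hj : j ∈ S
      · simp [hj, h2 j hj]
      · simpa [hj] using h1 j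
    · rintro rfl
      refine ⟨fun j => ?_, fun j hj => by simp [hj]⟩
      by_cases hj : j ∈ S <;> simp [hj]
  rw [← Finset.sum_filter, hfilter, Finset.sum_singleton]

/-! ### Degrees -/

/-- `φᵢ` preserves the degree. [folklore] -/
theorem proj_mem_degree (i : Fin n) {k : ℕ} {x : Chain N n R} (hx : x ∈ degree N n R k) :
    proj N n R i x ∈ degree N n R k := by
  refine apply_mem_of_mem_degree (fun c hc => ?_) hx
  rw [proj_single]
  split_ifs
  · exact Submodule.sum_mem _ fun a _ =>
      single_mem_degree (c := (Function.update c.1 i a, c.2)) hc (1 : R)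
  · exact Submodule.zero_mem _
  · exact single_mem_degree (c := (Function.update c.1 i 0, c.2)) hc (1 : R)

/-- `hᵢ` raises the degree by one. [folklore] -/
theorem homotopyOp_mem_degree (i : Fin n) {k : ℕ} {x : Chain N n R} (hx : x ∈ degree N n R k) :
    homotopyOp N n R i x ∈ degree N n R (k + 1) := by
  refine apply_mem_of_mem_degree (fun c hc => ?_) hx
  rw [homotopyOp_single]
  split_ifs with hi
  · exact Submodule.zero_mem _
  · refine Submodule.sum_mem _ fun b _ => single_mem_degree ?_ _
    rw [Cell.dim_def, Finset.card_insert_of_notMem hi, ← hc, Cell.dim_def]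

/-- `Ψ_k` preserves the degree. [folklore] -/
theorem projUpTo_mem_degree (k : ℕ) {m : ℕ} {x : Chain N n R} (hx : x ∈ degree N n R m) :
    projUpTo N n R k x ∈ degree N n R m := by
  induction k with
  | zero => simpa [projUpTo] using hx
  | succ k ih =>
    rw [projUpTo, Module.End.mul_apply, projStep]
    split_ifs
    · exact proj_mem_degree _ ih
    · simpa using ih

/-- `H_k` raises the degree by one. [folklore] -/
theorem homotopyUpTo_mem_degree (k : ℕ) {m : ℕ} {x : Chain N n R} (hx : x ∈ degree N n R m) :
    homotopyUpTo N n R k x ∈ degree N n R (m + 1) := by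
  induction k with
  | zero => simp [homotopyUpTo]
  | succ k ih =>
    rw [homotopyUpTo, LinearMap.add_apply, Module.End.mul_apply, homotopyStep]
    refine Submodule.add_mem _ ?_ ih
    split_ifs
    · exact homotopyOp_mem_degree _ (projUpTo_mem_degree k hx)
    · simp

/-- `read` preserves the degree. [folklore] -/
theorem read_mem_minimalDegree {k : ℕ} {x : Chain N n R} (hx : x ∈ degree N n R k) :
    read N n R x ∈ minimalDegree n R k := by
  refine apply_mem_of_mem_degree (fun c hc => ?_) hx
  rw [read_single]
  split_ifs
  · exact single_mem_minimalDegree hc 1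
  · exact Submodule.zero_mem _

/-- `fill` preserves the degree. [folklore] -/
theorem fill_mem_degree {k : ℕ} {l : MinimalChain n R} (hl : l ∈ minimalDegree n R k) :
    fill N n R l ∈ degree N n R k := by
  have h : (minimalDegree n R k).map (fill N n R) ≤ degree N n R k := by
    rw [minimalDegree_eq_span, Submodule.map_span_le]
    rintro _ ⟨S, rfl⟩
    rw [fill_single]
    exact Submodule.sum_mem _ fun w _ => single_mem_degree (c := (w, S.1)) S.2 (1 : R)
  exact h (Submodule.mem_map_of_mem hl)

/-- **`rank C_k = N^n · C(n, k)`**: the `k`-chains are free on the `k`-cells. [folklore] -/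
theorem finrank_degree [Nontrivial R] (k : ℕ) :
    Module.finrank R (degree N n R k) = N ^ n * n.choose k := by
  have hli : LinearIndependent R fun c : {c : Cell N n // c.dim = k} =>
      (Pi.single c.1 (1 : R) : Chain N n R) :=
    (Pi.linearIndependent_single_one (Cell N n) R).comp _ Subtype.val_injective
  have hspan : degree N n R k = Submodule.span R (Set.range fun c : {c : Cell N n // c.dim = k} =>
      (Pi.single c.1 (1 : R) : Chain N n R)) := by
    rw [degree_eq_span]
    congr 1
    ext x
    simp only [Set.mem_image, Set.mem_setOf_eq, Set.mem_range, Subtype.exists, exists_prop]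
  rw [hspan, finrank_span_eq_card hli, card_subtype_dim_eq]

/-! ### The homology -/

variable (N n R)

/-- `read` on the `k`-cycles, valued in `Λ_k`. [folklore] -/
def readCycles (k : ℕ) : cycles N n R k →ₗ[R] minimalDegree n R k :=
  (read N n R ∘ₗ (cycles N n R k).subtype).codRestrict (minimalDegree n R k) fun z =>
    read_mem_minimalDegree (mem_cycles_iff.1 z.2).2

/-- `fill` on `Λ_k`, valued in the `k`-cycles. [folklore] -/
def fillCycles (k : ℕ) : minimalDegree n R k →ₗ[R] cycles N n R k :=
  (fill N n R ∘ₗ (minimalDegree n R k).subtype).codRestrict (cycles N n R k) fun l =>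
    mem_cycles_iff.2 ⟨LinearMap.congr_fun boundary_comp_fill l.1, fill_mem_degree l.2⟩

/-- `read` kills the boundaries, hence descends to the homology. [folklore] -/
theorem boundaries_le_ker_readCycles (k : ℕ) :
    (boundaries N n R k).comap (cycles N n R k).subtype ≤ LinearMap.ker (readCycles N n R k) := by
  rintro z ⟨x, -, hx⟩
  rw [LinearMap.mem_ker]
  apply Subtype.ext
  change read N n R (z : Chain N n R) = 0
  rw [Submodule.coe_subtype] at hx
  rw [← hx, ← LinearMap.comp_apply, read_comp_boundary, LinearMap.zero_apply]

/-- `H_k → Λ_k`, induced by `read`. [folklore] -/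
def homologyToMinimal (k : ℕ) : homology N n R k →ₗ[R] minimalDegree n R k :=
  ((boundaries N n R k).comap (cycles N n R k).subtype).liftQ (readCycles N n R k)
    (boundaries_le_ker_readCycles N n R k)

/-- `Λ_k → H_k`, induced by `fill`. [folklore] -/
def minimalToHomology (k : ℕ) : minimalDegree n R k →ₗ[R] homology N n R k :=
  ((boundaries N n R k).comap (cycles N n R k).subtype).mkQ ∘ₗ fillCycles N n R k

/-- A cycle differs from `fill (read z)` by a boundary: `z - fill (read z) = ∂ (H z)`.
[folklore] -/
theorem sub_fill_read_eq (z : Chain N n R) (hz : boundary N n R z = 0) :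
    z - fill N n R (read N n R z) = boundary N n R (homotopyUpTo N n R n z) := by
  have h := LinearMap.congr_fun (boundary_homotopyUpTo (N := N) (n := n) (R := R) n) z
  rw [LinearMap.add_apply, Module.End.mul_apply, Module.End.mul_apply, hz, map_zero, add_zero,
    LinearMap.sub_apply, Module.End.one_apply, ← fill_comp_read, LinearMap.comp_apply] at h
  exact h.symm

/-- **`H_k((ℤ/N)^n; R) ≃ Λ_k`**: the homology of the cubical torus is that of the minimal torus
complex (zero differential), i.e. free on the `k`-sets of directions.
[cite: HatcherAT2002, §3.3 pp. 230–231] -/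
def homologyEquiv (k : ℕ) : homology N n R k ≃ₗ[R] minimalDegree n R k :=
  LinearEquiv.ofLinear (homologyToMinimal N n R k) (minimalToHomology N n R k)
    (by
      refine LinearMap.ext fun l => Subtype.ext ?_
      change read N n R (fill N n R (l : MinimalChain n R)) = l
      rw [← LinearMap.comp_apply, read_comp_fill, LinearMap.id_apply])
    (by
      refine Submodule.linearMap_qext _ (LinearMap.ext fun z => ?_)
      change ((boundaries N n R k).comap (cycles N n R k).subtype).mkQ
          (fillCycles N n R k (readCycles N n R k z)) =
        ((boundaries N n R k).comap (cycles N n R k).subtype).mkQ z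
      rw [Submodule.mkQ_apply, Submodule.mkQ_apply, Submodule.Quotient.eq, Submodule.mem_comap,
        Submodule.coe_subtype]
      change fill N n R (read N n R (z : Chain N n R)) - (z : Chain N n R) ∈ boundaries N n R k
      rw [← neg_sub, sub_fill_read_eq N n R _ (mem_cycles_iff.1 z.2).1]
      exact Submodule.neg_mem _ (Submodule.mem_map_of_mem
        (homotopyUpTo_mem_degree n (mem_cycles_iff.1 z.2).2)))

variable {N n R}

/-- **Betti numbers of the torus**: `b_k((ℤ/N)^n; R) = C(n, k)` for every nontrivial commutative
ring `R` (in particular over the field `𝔽₂`). [cite: HatcherAT2002, §3.3 pp. 230–231] -/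
theorem bettiNumber_eq [Nontrivial R] (k : ℕ) : bettiNumber N n R k = n.choose k := by
  rw [bettiNumber, (homologyEquiv N n R k).finrank_eq, finrank_minimalDegree]

/-- Above the dimension the Betti numbers vanish. [folklore] -/
theorem bettiNumber_eq_zero_of_lt [Nontrivial R] {k : ℕ} (hk : n < k) : bettiNumber N n R k = 0 := by
  rw [bettiNumber_eq, Nat.choose_eq_zero_of_lt hk]

/-- **Total Betti number of the torus**: `∑_{k ≤ n} b_k((ℤ/N)^n; R) = 2^n`.
[cite: HatcherAT2002, §3.3 pp. 230–231] -/
theorem sum_bettiNumber_eq [Nontrivial R] :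
    ∑ k ∈ Finset.range (n + 1), bettiNumber N n R k = 2 ^ n := by
  simp_rw [bettiNumber_eq]
  exact Nat.sum_range_choose n

end Ring

/-- The case of `𝔽₂`-coefficients used by discrete Morse theory on the torus:
`b_k((ℤ/N)^n; 𝔽₂) = C(n, k)`. [cite: HatcherAT2002, §3.3 pp. 230–231] -/
theorem bettiNumber_zmod_two [NeZero N] (k : ℕ) : bettiNumber N n (ZMod 2) k = n.choose k :=
  haveI : Fact (Nat.Prime 2) := ⟨Nat.prime_two⟩
  bettiNumber_eq k

/-- `∑_k b_k((ℤ/N)^n; 𝔽₂) = 2^n`. [cite: HatcherAT2002, §3.3 pp. 230–231] -/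
theorem sum_bettiNumber_zmod_two [NeZero N] :
    ∑ k ∈ Finset.range (n + 1), bettiNumber N n (ZMod 2) k = 2 ^ n :=
  haveI : Fact (Nat.Prime 2) := ⟨Nat.prime_two⟩
  sum_bettiNumber_eq

end CubicalTorus

end Literature.AlgebraicTopology.CellComplexes
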